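import Mathlib
import Literature.Probability.LatticeModels.ThermodynamicLimit
import Literature.Probability.LatticeModels.SharpnessProofs
import Summits.CriticalPhenomena.Ising3DConformalLimit.Theorems.PrecisionLaplacianDirectCorrelationStableTailExponentWindow
import HarnessLib

/-!
# Stub `stub_symbolIdentification` of line `diffusive-branch-is-nonsaturation` (crux
# `PrecisionLaplacian.DirectCorrelationStableTail`, stmt-CriticalPhenomena-4799) — auxiliary file:
# box exhaustion of lattice series, tail masses, the pointwise three-region bound, and the two mass estimates

Lead prover-line-stmt-CriticalPhenomena-4799-c4-0 (2026-08-17).  Pure theorem file (no definitions, no `sorry`).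

The identification stub shows that the rescaled Lévy–Khintchine symbol `ψ_R(k) = R^α Σ_y m(y)(1 − cos(k·y/R))`
of the precision row `m` converges to the stable symbol `|k|₂^α/(c C_α)`.  This file supplies the bookkeeping:

* `symId_tendsto_sum_box` — a summable lattice series is the limit of its partial sums over the centred boxes
  `box 3 L`, hence (`symId_abs_tsum_le_of_sum_box_le`) `|Σ' Z| ≤ δ` once every box sum of `|Z|` is `≤ δ`;
* `symId_tail_sum_le` — tightness at infinity read on complements of boxes:
  `Σ_{y ∈ T} m(y) ≤ C (M+1)^{-α}` for finite `T` disjoint from `box 3 M`;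
* `symId_sqrt_sum_sq_div`, `symId_sum_sq_div` — `|y/R|₂ = |y|₂/R`;
* `symId_pointwise` — the three-region bound on `|D(y/R) − Λ(1 − cos(k·y/R))|`: `ε₄|y|₂²/R²` on `box 3 R`
  (second-order estimate for `|y/R|₂ ≤ 1`, first-order one for `1 < |y/R|₂ ≤ √3 ≤ τ`), `ε₄` on `box 3 M₃`
  (`M₃ ≤ τR/2`, so `|y/R|₂ ≤ √3 τ/2 ≤ τ`), and `ε₄ + (B + 2Λ)` outside;
* with the tightness bounds of `stub_tightness` (at infinity `R^α Σ_{y∈T} m ≤ C` for finite `T ⊆ {‖y‖ ≥ R}`,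
  `R ≥ R₁`; at zero `Σ_{y ∈ box R} m(y)|y|₂² ≤ C' R^{2-α}`) and `m ≥ 0` off the origin:
  `symId_sum_split_le`, `symId_sum_min_le` (`Σ_{y ∈ box L} m(y) min(|y/R|₂², 1) ≤ (C' + C) R^{-α}`),
  `symId_sum_outside_le` (`Σ_{y ∈ box L, y ∉ box M} m(y) ≤ C (M+1)^{-α}`) and the registered sub-goal
  `stub_symbolIdentification_auxMass` = `symId_sum_bnd_le` (the box sum of `m ·` three-region weight is
  `≤ ε₄ (C' + C) R^{-α} + (B + 2Λ) C (M₃+1)^{-α}`).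

References: folklore (elementary real analysis on `ℤ³`).
-/

noncomputable section

namespace Summit.CriticalPhenomena.Ising3DConformalLimit.Cruxes.DirectCorrelationStableTail.DiffusiveBranchIsNonsaturation

open MeasureTheory Filter Topology
open scoped BigOperators
open Literature.Probability.LatticeModels

/-! ### Box exhaustion of lattice series -/

/-- A summable series over `ℤ³` is the limit of its partial sums over the centred boxes `box 3 L`. [folklore] -/
theorem symId_tendsto_sum_box {f : Site 3 → ℝ} (hf : Summable f) :
    Tendsto (fun L : ℕ => ∑ y ∈ box 3 L, f y) atTop (𝓝 (∑' y, f y)) := by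
  have hbox : Tendsto (fun L : ℕ => box 3 L) atTop atTop :=
    tendsto_atTop_finset_of_monotone (box_mono 3)
      fun y => ⟨Site.supNorm y, mem_box_iff_supNorm_le.2 le_rfl⟩
  exact hf.hasSum.comp hbox

/-- If the box sums of `|Z|` are eventually `≤ δ`, then `|Σ' Z| ≤ δ`. [folklore] -/
theorem symId_abs_tsum_le_of_sum_box_le {Z : Site 3 → ℝ} (hZ : Summable Z) {δ : ℝ}
    (h : ∀ᶠ L : ℕ in atTop, ∑ y ∈ box 3 L, |Z y| ≤ δ) : |∑' y, Z y| ≤ δ := by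
  have habs : Summable fun y => |Z y| := hZ.abs
  have hlim := symId_tendsto_sum_box habs
  have hle : (∑' y, |Z y|) ≤ δ := le_of_tendsto hlim h
  calc |∑' y, Z y| = ‖∑' y, Z y‖ := (Real.norm_eq_abs _).symm
    _ ≤ ∑' y, ‖Z y‖ := norm_tsum_le_tsum_norm hZ.norm
    _ = ∑' y, |Z y| := by simp only [Real.norm_eq_abs]
    _ ≤ δ := hle

/-! ### Tail masses from tightness at infinity -/

/-- Tightness at infinity read on the complement of a box: if `R^α Σ_{y∈T} m ≤ C` for finite `T ⊆ {‖y‖ ≥ R}`,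
`R ≥ R₁`, then for `M + 1 ≥ R₁` and finite `T` disjoint from `box 3 M`, `Σ_{y∈T} m(y) ≤ C (M+1)^{-α}`. [folklore] -/
theorem symId_tail_sum_le {m : Site 3 → ℝ} {α C : ℝ} {R₁ : ℕ}
    (hinf : ∀ R : ℕ, R₁ ≤ R → ∀ T : Finset (Site 3), (∀ y ∈ T, (R : ℝ) ≤ ‖y‖) →
      (R : ℝ) ^ α * ∑ y ∈ T, m y ≤ C)
    {M : ℕ} (hM : R₁ ≤ M + 1) (T : Finset (Site 3)) (hT : ∀ y ∈ T, y ∉ box 3 M) :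
    ∑ y ∈ T, m y ≤ C * ((M : ℝ) + 1) ^ (-α) := by
  have hpos : (0 : ℝ) < (M : ℝ) + 1 := by positivity
  have key := hinf (M + 1) hM T fun y hy => by
    have h := hT y hy
    rw [mem_box_iff_supNorm_le, not_le] at h
    rw [Site.norm_eq_supNorm]
    exact_mod_cast h
  push_cast at key
  rw [Real.rpow_neg hpos.le, ← div_eq_mul_inv, le_div_iff₀ (Real.rpow_pos_of_pos hpos α), mul_comm]
  exact key

/-- The constant of tightness at infinity is nonnegative (take `T = ∅`). [folklore] -/
theorem symId_C_nonneg {m : Site 3 → ℝ} {α C : ℝ} {R₁ : ℕ}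
    (hinf : ∀ R : ℕ, R₁ ≤ R → ∀ T : Finset (Site 3), (∀ y ∈ T, (R : ℝ) ≤ ‖y‖) →
      (R : ℝ) ^ α * ∑ y ∈ T, m y ≤ C) : 0 ≤ C := by
  simpa using hinf R₁ le_rfl ∅ (by simp)

/-- The constant of tightness at zero is nonnegative (take `R = 1`; the `y = 0` term vanishes and the others are
nonnegative). [folklore] -/
theorem symId_C'_nonneg {m : Site 3 → ℝ} {α C' : ℝ} (hnn : ∀ y, y ≠ 0 → 0 ≤ m y)
    (hzer : ∀ R : ℕ, 1 ≤ R → ∑ y ∈ box 3 R, m y * (∑ i, ((y i : ℝ)) ^ 2) ≤ C' * (R : ℝ) ^ (2 - α)) :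
    0 ≤ C' := by
  have h := hzer 1 le_rfl
  simp only [Nat.cast_one, Real.one_rpow, mul_one] at h
  refine le_trans (Finset.sum_nonneg fun y _ => ?_) h
  by_cases hy : y = 0
  · subst hy; simp
  · exact mul_nonneg (hnn y hy) (Finset.sum_nonneg fun i _ => sq_nonneg _)

/-- The weighted second moment over a box is termwise nonnegative. [folklore] -/
theorem symId_moment_term_nonneg {m : Site 3 → ℝ} (hnn : ∀ y, y ≠ 0 → 0 ≤ m y) (y : Site 3) :
    0 ≤ m y * (∑ i, ((y i : ℝ)) ^ 2) := by
  by_cases hy : y = 0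
  · subst hy; simp
  · exact mul_nonneg (hnn y hy) (Finset.sum_nonneg fun i _ => sq_nonneg _)

/-! ### Euclidean bookkeeping for `u = y/R` -/

/-- `Σᵢ (yᵢ/R)² = (Σᵢ yᵢ²)/R²`. [folklore] -/
theorem symId_sum_sq_div (y : Site 3) (R : ℝ) :
    (∑ i, ((y i : ℝ) / R) ^ 2) = (∑ i, ((y i : ℝ)) ^ 2) / R ^ 2 := by
  rw [Finset.sum_div]
  refine Finset.sum_congr rfl fun i _ => ?_
  rw [div_pow]

/-- `|y/R|₂ = |y|₂/R` for `R > 0`. [folklore] -/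
theorem symId_sqrt_sum_sq_div (y : Site 3) {R : ℝ} (hR : 0 < R) :
    Real.sqrt (∑ i, ((y i : ℝ) / R) ^ 2) = Real.sqrt (∑ i, ((y i : ℝ)) ^ 2) / R := by
  rw [symId_sum_sq_div, Real.sqrt_div' _ (sq_nonneg R), Real.sqrt_sq hR.le]

/-- On `box 3 M` the Euclidean norm is at most `√3 M`. [folklore] -/
theorem symId_euclid_le_of_mem_box {y : Site 3} {M : ℕ} (hy : y ∈ box 3 M) :
    Real.sqrt (∑ i, ((y i : ℝ)) ^ 2) ≤ Real.sqrt 3 * M := by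
  have h1 := expWin_euclid_le_sqrt_three_mul_norm y
  have h2 : ‖y‖ ≤ (M : ℝ) := by
    rw [Site.norm_eq_supNorm]
    exact_mod_cast mem_box_iff_supNorm_le.1 hy
  exact h1.trans (mul_le_mul_of_nonneg_left h2 (Real.sqrt_nonneg _))

/-- `√3 ≤ 2`. [folklore] -/
theorem symId_sqrt_three_le_two : Real.sqrt 3 ≤ 2 := by
  have h4 : Real.sqrt 4 = 2 := by
    rw [show (4 : ℝ) = 2 ^ 2 by norm_num]
    exact Real.sqrt_sq (by norm_num)
  calc Real.sqrt 3 ≤ Real.sqrt 4 := Real.sqrt_le_sqrt (by norm_num)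
    _ = 2 := h4

/-! ### The pointwise three-region bound -/

/-- **Three-region bound.**  Let `D` satisfy the first-order estimate `|D(u) − Λ(1 − cos k·u)| ≤ ε₄` for
`|u|₂ ≤ τ`, the second-order estimate `≤ ε₄|u|₂²` for `|u|₂ ≤ 1`, and `|D| ≤ B`; let `τ ≥ 2`, `R ≥ 1`,
`M₃ ≤ τR/2`.  Then for every lattice point `y`, with `u = y/R`:
`|D(u) − Λ(1 − cos k·u)| ≤ ε₄|y|₂²/R²` if `y ∈ box 3 R`, `≤ ε₄` if `y ∈ box 3 M₃`, and `≤ ε₄ + (B + 2Λ)` otherwise.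
[folklore] -/
theorem symId_pointwise {D : (Fin 3 → ℝ) → ℝ} {k : Fin 3 → ℝ} {Λ ε₄ B τ : ℝ} {R M₃ : ℕ}
    (hR : 1 ≤ R) (hτ : 2 ≤ τ) (hM₃ : (M₃ : ℝ) ≤ τ * R / 2) (hΛ : 0 ≤ Λ) (hε₄ : 0 ≤ ε₄)
    (ha : ∀ u : Fin 3 → ℝ, Real.sqrt (∑ i, u i ^ 2) ≤ τ →
      |D u - Λ * (1 - Real.cos (∑ i, k i * u i))| ≤ ε₄)
    (hb : ∀ u : Fin 3 → ℝ, Real.sqrt (∑ i, u i ^ 2) ≤ 1 →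
      |D u - Λ * (1 - Real.cos (∑ i, k i * u i))| ≤ ε₄ * ∑ i, u i ^ 2)
    (hcB : ∀ u : Fin 3 → ℝ, |D u| ≤ B) (y : Site 3) :
    |D (fun i => (y i : ℝ) / R) - Λ * (1 - Real.cos (∑ i, k i * ((y i : ℝ) / R)))| ≤
      (if y ∈ box 3 R then ε₄ * (∑ i, ((y i : ℝ)) ^ 2) / (R : ℝ) ^ 2
        else if y ∈ box 3 M₃ then ε₄ else ε₄ + (B + 2 * Λ)) := by
  have hRpos : (0 : ℝ) < R := by exact_mod_cast hR
  set u : Fin 3 → ℝ := fun i => (y i : ℝ) / R with hu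
  have hnormu : Real.sqrt (∑ i, u i ^ 2) = Real.sqrt (∑ i, ((y i : ℝ)) ^ 2) / R :=
    symId_sqrt_sum_sq_div y hRpos
  have hsumu : (∑ i, u i ^ 2) = (∑ i, ((y i : ℝ)) ^ 2) / (R : ℝ) ^ 2 := symId_sum_sq_div y R
  have h3 := symId_sqrt_three_le_two
  by_cases hyR : y ∈ box 3 R
  · rw [if_pos hyR]
    -- `|u|₂ ≤ √3 ≤ 2 ≤ τ`
    have hle : Real.sqrt (∑ i, u i ^ 2) ≤ Real.sqrt 3 := by
      rw [hnormu, div_le_iff₀ hRpos]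
      exact symId_euclid_le_of_mem_box hyR
    by_cases hu1 : Real.sqrt (∑ i, u i ^ 2) ≤ 1
    · calc |D u - Λ * (1 - Real.cos (∑ i, k i * u i))| ≤ ε₄ * ∑ i, u i ^ 2 := hb u hu1
        _ = ε₄ * (∑ i, ((y i : ℝ)) ^ 2) / (R : ℝ) ^ 2 := by rw [hsumu, mul_div_assoc]
    · have hge : 1 ≤ ∑ i, u i ^ 2 := by
        rw [not_le] at hu1
        have h0 : 0 ≤ ∑ i, u i ^ 2 := Finset.sum_nonneg fun i _ => sq_nonneg _
        nlinarith [Real.sq_sqrt h0, Real.sqrt_nonneg (∑ i, u i ^ 2)]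
      calc |D u - Λ * (1 - Real.cos (∑ i, k i * u i))| ≤ ε₄ := ha u (by linarith)
        _ ≤ ε₄ * ∑ i, u i ^ 2 := le_mul_of_one_le_right hε₄ hge
        _ = ε₄ * (∑ i, ((y i : ℝ)) ^ 2) / (R : ℝ) ^ 2 := by rw [hsumu, mul_div_assoc]
  · rw [if_neg hyR]
    by_cases hyM : y ∈ box 3 M₃
    · rw [if_pos hyM]
      refine ha u ?_
      rw [hnormu, div_le_iff₀ hRpos]
      calc Real.sqrt (∑ i, ((y i : ℝ)) ^ 2) ≤ Real.sqrt 3 * M₃ := symId_euclid_le_of_mem_box hyM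
        _ ≤ 2 * (τ * R / 2) := mul_le_mul h3 hM₃ (Nat.cast_nonneg _) (by norm_num)
        _ = τ * R := by ring
    · rw [if_neg hyM]
      have hcos : |1 - Real.cos (∑ i, k i * u i)| ≤ 2 := by
        have h1 := Real.cos_le_one (∑ i, k i * u i)
        have h2 := Real.neg_one_le_cos (∑ i, k i * u i)
        rw [abs_le]; constructor <;> linarith
      calc |D u - Λ * (1 - Real.cos (∑ i, k i * u i))|
          ≤ |D u| + |Λ * (1 - Real.cos (∑ i, k i * u i))| := abs_sub _ _
        _ ≤ B + Λ * 2 := by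
            rw [abs_mul, abs_of_nonneg hΛ]
            exact add_le_add (hcB u) (mul_le_mul_of_nonneg_left hcos hΛ)
        _ ≤ ε₄ + (B + 2 * Λ) := by linarith


/-- `R^{2-α}/R² = R^{-α}` and `(R+1)^{-α} ≤ R^{-α}` bookkeeping: for `R ≥ 1`,
`C' R^{2-α} / R² + C (R+1)^{-α} ≤ (C' + C) R^{-α}` when `C ≥ 0`. [folklore] -/
theorem symId_rpow_bookkeeping {α C C' : ℝ} (hα : 0 ≤ α) (hC : 0 ≤ C) {R : ℕ} (hR : 1 ≤ R) :
    C' * (R : ℝ) ^ (2 - α) / (R : ℝ) ^ 2 + C * ((R : ℝ) + 1) ^ (-α) ≤ (C' + C) * (R : ℝ) ^ (-α) := by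
  have hRpos : (0 : ℝ) < R := by exact_mod_cast hR
  have h1 : (R : ℝ) ^ (2 - α) / (R : ℝ) ^ 2 = (R : ℝ) ^ (-α) := by
    rw [div_eq_iff (pow_ne_zero 2 hRpos.ne'), ← Real.rpow_natCast (R : ℝ) 2, ← Real.rpow_add hRpos]
    congr 1
    push_cast
    ring
  have h2 : ((R : ℝ) + 1) ^ (-α) ≤ (R : ℝ) ^ (-α) :=
    Real.rpow_le_rpow_of_nonpos hRpos (by linarith) (by linarith)
  calc C' * (R : ℝ) ^ (2 - α) / (R : ℝ) ^ 2 + C * ((R : ℝ) + 1) ^ (-α)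
      = C' * (R : ℝ) ^ (-α) + C * ((R : ℝ) + 1) ^ (-α) := by rw [mul_div_assoc, h1]
    _ ≤ C' * (R : ℝ) ^ (-α) + C * (R : ℝ) ^ (-α) := by
        exact add_le_add le_rfl (mul_le_mul_of_nonneg_left h2 hC)
    _ = (C' + C) * (R : ℝ) ^ (-α) := by ring

/-- **Split mass bound.**  `Σ_{y ∈ box L} [y ∈ box R ? m(y)|y|₂²/R² : m(y)] ≤ (C' + C) R^{-α}` for `R ≥ max(R₁,1)`.
[folklore] -/
theorem symId_sum_split_le {m : Site 3 → ℝ} {α C C' : ℝ} {R₁ : ℕ} (hnn : ∀ y, y ≠ 0 → 0 ≤ m y)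
    (hα : 0 ≤ α)
    (hinf : ∀ R : ℕ, R₁ ≤ R → ∀ T : Finset (Site 3), (∀ y ∈ T, (R : ℝ) ≤ ‖y‖) →
      (R : ℝ) ^ α * ∑ y ∈ T, m y ≤ C)
    (hzer : ∀ R : ℕ, 1 ≤ R → ∑ y ∈ box 3 R, m y * (∑ i, ((y i : ℝ)) ^ 2) ≤ C' * (R : ℝ) ^ (2 - α))
    {R : ℕ} (hR : 1 ≤ R) (hRR₁ : R₁ ≤ R) (L : ℕ) :
    ∑ y ∈ box 3 L, (if y ∈ box 3 R then m y * (∑ i, ((y i : ℝ)) ^ 2) / (R : ℝ) ^ 2 else m y) ≤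
      (C' + C) * (R : ℝ) ^ (-α) := by
  classical
  have hC := symId_C_nonneg hinf
  rw [Finset.sum_ite]
  -- the inner part: a sub-sum of the second moment over `box 3 R`
  have hin : ∑ y ∈ (box 3 L).filter (fun y => y ∈ box 3 R), m y * (∑ i, ((y i : ℝ)) ^ 2) / (R : ℝ) ^ 2
      ≤ C' * (R : ℝ) ^ (2 - α) / (R : ℝ) ^ 2 := by
    rw [← Finset.sum_div]
    refine div_le_div_of_nonneg_right ?_ (sq_nonneg _)
    calc ∑ y ∈ (box 3 L).filter (fun y => y ∈ box 3 R), m y * (∑ i, ((y i : ℝ)) ^ 2)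
        ≤ ∑ y ∈ box 3 R, m y * (∑ i, ((y i : ℝ)) ^ 2) := by
          refine Finset.sum_le_sum_of_subset_of_nonneg (fun y hy => (Finset.mem_filter.1 hy).2)
            fun y _ _ => symId_moment_term_nonneg hnn y
      _ ≤ C' * (R : ℝ) ^ (2 - α) := hzer R hR
  -- the outer part: a tail mass
  have hout : ∑ y ∈ (box 3 L).filter (fun y => ¬ y ∈ box 3 R), m y ≤ C * ((R : ℝ) + 1) ^ (-α) :=
    symId_tail_sum_le hinf (by omega) _ fun y hy => (Finset.mem_filter.1 hy).2
  exact (add_le_add hin hout).trans (symId_rpow_bookkeeping hα hC hR)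

/-- **Mass bound for the weight `min(|y/R|₂², 1)`**: `Σ_{y ∈ box L} m(y) min(|y/R|₂², 1) ≤ (C' + C) R^{-α}`.
[folklore] -/
theorem symId_sum_min_le {m : Site 3 → ℝ} {α C C' : ℝ} {R₁ : ℕ} (hnn : ∀ y, y ≠ 0 → 0 ≤ m y)
    (hα : 0 ≤ α)
    (hinf : ∀ R : ℕ, R₁ ≤ R → ∀ T : Finset (Site 3), (∀ y ∈ T, (R : ℝ) ≤ ‖y‖) →
      (R : ℝ) ^ α * ∑ y ∈ T, m y ≤ C)
    (hzer : ∀ R : ℕ, 1 ≤ R → ∑ y ∈ box 3 R, m y * (∑ i, ((y i : ℝ)) ^ 2) ≤ C' * (R : ℝ) ^ (2 - α))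
    {R : ℕ} (hR : 1 ≤ R) (hRR₁ : R₁ ≤ R) (L : ℕ) :
    ∑ y ∈ box 3 L, m y * min (∑ i, ((y i : ℝ) / R) ^ 2) 1 ≤ (C' + C) * (R : ℝ) ^ (-α) := by
  classical
  refine le_trans (Finset.sum_le_sum fun y _ => ?_) (symId_sum_split_le hnn hα hinf hzer hR hRR₁ L)
  by_cases hy0 : y = 0
  · subst hy0
    simp
  have hmy := hnn y hy0
  by_cases hyR : y ∈ box 3 R
  · rw [if_pos hyR, mul_div_assoc, ← symId_sum_sq_div y (R : ℝ)]
    exact mul_le_mul_of_nonneg_left (min_le_left _ _) hmy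
  · rw [if_neg hyR]
    calc m y * min (∑ i, ((y i : ℝ) / R) ^ 2) 1 ≤ m y * 1 := mul_le_mul_of_nonneg_left (min_le_right _ _) hmy
      _ = m y := mul_one _

/-- **Outside mass**: `Σ_{y ∈ box L, y ∉ box M} m(y) ≤ C (M+1)^{-α}` for `M + 1 ≥ R₁`. [folklore] -/
theorem symId_sum_outside_le {m : Site 3 → ℝ} {α C : ℝ} {R₁ : ℕ}
    (hinf : ∀ R : ℕ, R₁ ≤ R → ∀ T : Finset (Site 3), (∀ y ∈ T, (R : ℝ) ≤ ‖y‖) →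
      (R : ℝ) ^ α * ∑ y ∈ T, m y ≤ C)
    {M : ℕ} (hM : R₁ ≤ M + 1) (L : ℕ) :
    ∑ y ∈ box 3 L, (if y ∉ box 3 M then m y else 0) ≤ C * ((M : ℝ) + 1) ^ (-α) := by
  classical
  rw [Finset.sum_ite, Finset.sum_const_zero, add_zero]
  exact symId_tail_sum_le hinf hM _ fun y hy => (Finset.mem_filter.1 hy).2

/-- **Mass bound for the three-region weight** of `symId_pointwise`: for `1 ≤ R ≤ M₃`, `R₁ ≤ R`, `ε₄ ≥ 0`,
`B + 2Λ ≥ 0`,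
`Σ_{y ∈ box L} m(y)·bnd(y) ≤ ε₄ (C' + C) R^{-α} + (B + 2Λ) C (M₃+1)^{-α}`. [folklore] -/
theorem symId_sum_bnd_le {m : Site 3 → ℝ} {α C C' ε₄ B Λ : ℝ} {R₁ : ℕ} (hnn : ∀ y, y ≠ 0 → 0 ≤ m y)
    (hα : 0 ≤ α)
    (hinf : ∀ R : ℕ, R₁ ≤ R → ∀ T : Finset (Site 3), (∀ y ∈ T, (R : ℝ) ≤ ‖y‖) →
      (R : ℝ) ^ α * ∑ y ∈ T, m y ≤ C)
    (hzer : ∀ R : ℕ, 1 ≤ R → ∑ y ∈ box 3 R, m y * (∑ i, ((y i : ℝ)) ^ 2) ≤ C' * (R : ℝ) ^ (2 - α))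
    {R M₃ : ℕ} (hR : 1 ≤ R) (hRR₁ : R₁ ≤ R) (hRM : R ≤ M₃) (hε₄ : 0 ≤ ε₄) (hBΛ : 0 ≤ B + 2 * Λ) (L : ℕ) :
    ∑ y ∈ box 3 L, m y * (if y ∈ box 3 R then ε₄ * (∑ i, ((y i : ℝ)) ^ 2) / (R : ℝ) ^ 2
        else if y ∈ box 3 M₃ then ε₄ else ε₄ + (B + 2 * Λ)) ≤
      ε₄ * ((C' + C) * (R : ℝ) ^ (-α)) + (B + 2 * Λ) * (C * ((M₃ : ℝ) + 1) ^ (-α)) := by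
  classical
  have hsub : box 3 R ⊆ box 3 M₃ := box_mono 3 hRM
  -- pointwise identity with the two elementary weights
  have hpt : ∀ y ∈ box 3 L, m y * (if y ∈ box 3 R then ε₄ * (∑ i, ((y i : ℝ)) ^ 2) / (R : ℝ) ^ 2
      else if y ∈ box 3 M₃ then ε₄ else ε₄ + (B + 2 * Λ)) =
      ε₄ * (if y ∈ box 3 R then m y * (∑ i, ((y i : ℝ)) ^ 2) / (R : ℝ) ^ 2 else m y) +
        (B + 2 * Λ) * (if y ∉ box 3 M₃ then m y else 0) := by
    intro y _
    by_cases hyR : y ∈ box 3 R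
    · have hyM : y ∈ box 3 M₃ := hsub hyR
      rw [if_pos hyR, if_pos hyR, if_neg (not_not.2 hyM)]
      ring
    · rw [if_neg hyR, if_neg hyR]
      by_cases hyM : y ∈ box 3 M₃
      · rw [if_pos hyM, if_neg (not_not.2 hyM)]
        ring
      · rw [if_neg hyM, if_pos hyM]
        ring
  rw [Finset.sum_congr rfl hpt, Finset.sum_add_distrib, ← Finset.mul_sum, ← Finset.mul_sum]
  have hM₃ : R₁ ≤ M₃ + 1 := by omega
  exact add_le_add (mul_le_mul_of_nonneg_left (symId_sum_split_le hnn hα hinf hzer hR hRR₁ L) hε₄)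
    (mul_le_mul_of_nonneg_left (symId_sum_outside_le hinf hM₃ L) hBΛ)


/-- **Registered sub-goal `stub_symbolIdentification_auxMass`** (= `symId_sum_bnd_le` with explicit binders): the box
sum of `m ·` (three-region weight) is `≤ ε₄ (C' + C) R^{-α} + (B + 2Λ) C (M₃+1)^{-α}`. [folklore] -/
theorem stub_symbolIdentification_auxMass :
    ∀ (m : Site 3 → ℝ) (α C C' ε₄ B Λ : ℝ) (R₁ R M₃ L : ℕ), (∀ y, y ≠ 0 → 0 ≤ m y) → 0 ≤ α →
      (∀ R : ℕ, R₁ ≤ R → ∀ T : Finset (Site 3), (∀ y ∈ T, (R : ℝ) ≤ ‖y‖) → (R : ℝ) ^ α * ∑ y ∈ T, m y ≤ C) →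
      (∀ R : ℕ, 1 ≤ R → ∑ y ∈ box 3 R, m y * (∑ i, ((y i : ℝ)) ^ 2) ≤ C' * (R : ℝ) ^ (2 - α)) →
      1 ≤ R → R₁ ≤ R → R ≤ M₃ → 0 ≤ ε₄ → 0 ≤ B + 2 * Λ →
      ∑ y ∈ box 3 L, m y * (if y ∈ box 3 R then ε₄ * (∑ i, ((y i : ℝ)) ^ 2) / (R : ℝ) ^ 2
          else if y ∈ box 3 M₃ then ε₄ else ε₄ + (B + 2 * Λ)) ≤
        ε₄ * ((C' + C) * (R : ℝ) ^ (-α)) + (B + 2 * Λ) * (C * ((M₃ : ℝ) + 1) ^ (-α)) :=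
  fun _ _ _ _ _ _ _ _ _ _ _ hnn hα hinf hzer hR hRR₁ hRM hε₄ hBΛ =>
    symId_sum_bnd_le hnn hα hinf hzer hR hRR₁ hRM hε₄ hBΛ _

end Summit.CriticalPhenomena.Ising3DConformalLimit.Cruxes.DirectCorrelationStableTail.DiffusiveBranchIsNonsaturation

end
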